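import Literature.AlgebraicGeometry.HodgeTheory.BettiHodgeConjectureProductOfSurfacesCorrespondenceCriterion
import Literature.AlgebraicGeometry.HodgeTheory.BettiHodgeConjectureProductsReducedKunnethPieces
import HarnessLib

/-!
# `HC(T × T')` for two smooth projective threefolds with the middle piece `H³(T) ⊗ H³(T')` by algebraic correspondences: the `(3,3)`-component of an algebraic class is algebraic once the
# `(2,2)`-piece of `H⁴` is, and `HC(T × T') ⟺ dim_ℚ Hom_HS(H³T, H³T') ≤ dim_ℂ ⟨actions H³(T';ℂ) → H³(T;ℂ) of algebraic classes⟩` given the `H⁴`-pieces; generic piece lemmas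
# (Voisin I §11.3.3 Thm. 11.38–11.40, Lemma 11.41, p. 287, §6.2.3 Thm. 6.25, §11.3.1 Thm. 11.30; Voisin II Prop. 9.20, (10.7); Voisin 2013 Lemma 2.1; Deligne 2000 §1)

Family `hodge`, lane `lit-hodgefound` (Track 2 foundations library; Layers A1/A4), layer `Literature/AlgebraicGeometry/HodgeTheory`.  THEOREMS ONLY (no definition, no named fact, no instance;
D-0026 net debt `0`).  The seat's g29-#3 (`BettiHodgeConjectureProductsReducedKunnethPieces`) proved `HC(T × T')` for two smooth projective threefolds from the algebraicity of the Hodge classes of the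
pieces `H¹T ⊗ H³T'`, `H²T ⊗ H²T'`, `H³T ⊗ H¹T'` of `H⁴(T × T')` and `H³T ⊗ H³T'` of `H⁶(T × T')`, and read the middle piece only through `Hom_HS(H³T, H³T') = 0`; g29-#5 allowed `dim End_HS(H³T) ≤ 1` on
a square.  With the seat's g30-#5 (component of an algebraic class when the OTHER pieces are algebraic; numeric criterion) the middle piece is now governed by ALGEBRAIC CORRESPONDENCES: in
`H⁶(T × T')` the pieces `H⁰⊗H⁶`, `H⁶⊗H⁰`, `H¹⊗H⁵`, `H⁵⊗H¹` are free and `H²⊗H⁴`, `H⁴⊗H²` reduce by hard Lefschetz (g29-#2) to the `(2,2)`-piece of `H⁴`, so once that piece is algebraic the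
`(3,3)`-component of any algebraic class is algebraic with the same action `H³(T';ℂ) → H³(T;ℂ)`, and **`HC(T × T') ⟺ dim_ℚ Hom_HS(H³T, H³T') ≤ dim_ℂ ⟨(γ ⊗ 1)_* : γ ∈ H⁶(T × T';ℚ), γ ⊗ 1 ∈ N³⟩`**
given the three `H⁴`-pieces — e.g. for regular threefolds with `h^{2,0}(T) = 0` (quintic threefolds, Calabi–Yau threefolds): `HC(T × T')` iff the morphisms of Hodge structures `H³(T') → H³(T)`
are accounted for, in action, by algebraic correspondences.

WHAT IS PROVED.
* §1 GENERIC PIECE LEMMAS (any `Y`, `Z`): **`BettiUniverse.kunneth_piece_algebraic_of_subsingleton_hom_tateTwist`** (`Hom_HS(HᵏY, HˡZ(s)) = 0`, `l − 2s = k` ⇒ the piece `HᵏY ⊗ HˡZ ⊂ H^{2(k+s)}` has no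
  Hodge class, so its Hodge classes are trivially algebraic), **`…_of_subsingleton_hom_tateTwist_swap`** (the same from `Hom_HS(HˡZ, HᵏY(−s)) = 0`), **`BettiUniverse.kunneth_two_two_algebraic_of_finrank_hom_le`**
  (`dim_ℚ Hom_HS(H²Y, H²Z) ≤ ρ(Y)ρ(Z)` ⇒ the piece `H²Y ⊗ H²Z ⊂ H⁴(Y × Z)` is algebraic: spanned by products of divisor classes).
* §2 **`BettiUniverse.kunneth_threefolds_ne_three_three_algebraic_of_two_two`**, **`BettiUniverse.exists_kunneth_three_three_algebraic_corrAction_eq_of_two_two`**.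
* §3 **`BettiUniverse.hodgeConjectureFor_tensor_threefolds_iff_finrank_hom_le_finrank_span_of_kunneth_pieces`** (given the `H⁴`-pieces `(1,3)`, `(2,2)`, `(3,1)`), family form
  **`BettiUniverse.hodgeConjectureFor_tensor_threefolds_of_kunneth_pieces_of_linearIndependent_corrAction`**.
* §4 HOM FORMS: **`BettiUniverse.hodgeConjectureFor_tensor_threefolds_of_hom_odd_of_finrank_hom_le_of_finrank_hom_three_le_finrank_span`** (`Hom_HS(H¹T, H³T'(1)) = Hom_HS(H¹T', H³T(1)) = 0`,
  `dim Hom_HS(H²T, H²T') ≤ ρρ'`, numeric `(3,3)` criterion ⇒ `HC(T × T')`), **`…_of_q_zero_of_h20_zero_of_finrank_hom_three_le_finrank_span`** (`q(T) = q(T') = 0`, `h^{2,0}(T) = 0`), and the square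
  **`BettiUniverse.hodgeConjectureFor_tensor_self_threefold_iff_finrank_end_le_finrank_span_of_q_zero_of_h20_zero`** (`HC(T × T) ⟺ dim_ℚ End_HS(H³T) ≤ dim_ℂ ⟨algebraic self-correspondence actions on H³(T;ℂ)⟩`).

THE PRINTS.  C. Voisin (2002) [VoisinHodgeI2002] §6.2.3 Thm. 6.25; §11.1.2 Prop. 11.20; §11.3.1 Thm. 11.30; §11.3.3 Thm. 11.38–11.40, Lemma 11.41 and pp. 286–287.  C. Voisin (2003) [VoisinHodgeII2003] §9.2.4 Prop. 9.20;
§10.2.2 proof of Thm. 10.17, (10.7).  C. Voisin (2013) [Voisin2013GHCBloch] Lemma 2.1.  C. Voisin (2025) [Voisin2025] §3.2.1 (12)–(14), Prop. 3.8, Cor. 3.9.  P. Deligne (1971) [DeligneHodgeII1971] 2.1.13.  P. Deligne (2000/2006)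
[Deligne2000] §1.  A. Hatcher (2002) [HatcherAT2002] §3.1 p. 198, §3.3 Prop. 3.38.

THE OBJECTS (all the tree's).  `corrAction μ hT hT' hab`, `kunnethPiece`, `BettiUniverse.crossMap`, `BettiUniverse.kunnethSummand`, `BettiUniverse.hodge hHD hX k`, `hodgeClasses`, `hodgeNumber`, `HodgeStructure.Hom`,
`tensor`, `tateTwist`, `cast`, `bettiCohomology`, `complexBetti`, `ofRatClass`, `algebraicClasses`, `HodgeConjectureFor`; `ρ(X) = dim_ℚ Hdg¹(H²X)`.

DEVIATIONS / SCOPE.  The `H⁴`-pieces `(1,3)`, `(2,2)`, `(3,1)` are hypotheses (discharged in §4 by Hom conditions as in g29-#3); which algebraic correspondences `T ⊢ T'` exist is the geometry of the pair.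
No definitions.

## References
* [VoisinHodgeI2002] C. Voisin, *Hodge Theory and Complex Algebraic Geometry I* (2002) — §6.2.3 Thm. 6.25; §11.1.2 Prop. 11.20; §11.3.1 Thm. 11.30; §11.3.3 Thm. 11.38, Thm. 11.40, Lemma 11.41, pp. 286–287.
* [VoisinHodgeII2003] C. Voisin, *Hodge Theory and Complex Algebraic Geometry II* (2003) — §9.2.4 Prop. 9.20; §10.2.2 proof of Thm. 10.17 (10.7).
* [Voisin2013GHCBloch] C. Voisin, *The generalized Hodge and Bloch conjectures are equivalent for general complete intersections* (2013) — Lemma 2.1.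
* [Voisin2025] C. Voisin, *Cycle classes on algebraic varieties* (2025) — §3.2.1 (12)–(14), Prop. 3.8, Cor. 3.9.
* [DeligneHodgeII1971] P. Deligne, *Théorie de Hodge II*, Publ. Math. IHÉS 40 (1971) — 2.1.13.
* [Deligne2000] P. Deligne, *The Hodge conjecture* (Clay problem description) — §1.
* [HatcherAT2002] A. Hatcher, *Algebraic Topology* (2002) — §3.1 p. 198; §3.3 Prop. 3.38.

## Provenance
Lane `lit-hodgefound` (Hodge path, Track 2), prover seat `lit-hodgefound-p29` (generation 30), self-proposed row g30-#6 (g29-#3 with the middle piece by correspondences, via g30-#5 §1).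
-/

noncomputable section

open scoped TensorProduct
open CategoryTheory MonoidalCategory CartesianMonoidalCategory Module Finset
open Literature.AlgebraicTopology.SingularHomology
open Literature.Geometry.Kaehler

namespace Literature.AlgebraicGeometry.HodgeTheory

open Literature.AlgebraicGeometry.Motives
open Literature.AlgebraicGeometry.Motives.HodgeStructure

variable {m n d : ℕ} {X Y Z T T' : SchemeOver ℂ}

/-! ### §0 Plumbing -/

/-- The space of ℂ-linear maps `Hᵃ(Z;ℂ) → Hⁱ(Y;ℂ)` is finite-dimensional. [cite: VoisinHodgeI2002, §7.1.1] -/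
private theorem finite_hom_complexBetti (hY : IsSmoothProjective m Y) (hZ : IsSmoothProjective n Z) (i a : ℕ) : Module.Finite ℂ (complexBetti Z a →ₗ[ℂ] complexBetti Y i) := by
  haveI := finite_complexBetti hZ a
  haveI := finite_complexBetti hY i
  infer_instance

/-! ### §1 Generic piece lemmas -/

section Generic

variable [HodgeTensorFacts.{0, 0}]

/-- **A piece with no morphism of Hodge structures carries no Hodge class**: if `Hom_HS(Hᵏ(Y), Hˡ(Z)(s)) = 0` (`l − 2s = k`), then every Hodge class of the summand `Hᵏ(Y) ⊗ Hˡ(Z)` of `H^{2c}(Y × Z)`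
(`k + l = 2c`, Hodge degree `c = k + s`) is zero, so its cross product is (trivially) algebraic (Lemma 11.41). [cite: VoisinHodgeI2002, §11.3.3 Thm. 11.40, Lemma 11.41 and p. 286] -/
theorem BettiUniverse.kunneth_piece_algebraic_of_subsingleton_hom_tateTwist (hHD : exists_isReal_hodgeModel) (hY : IsSmoothProjective m Y) (hZ : IsSmoothProjective n Z) {k l c : ℕ}
    (hkl : k + l = 2 * c) {s : ℤ} (hs : (l : ℤ) - 2 * s = k) (hcs : (k : ℤ) + s = c)
    (h : Subsingleton (HodgeStructure.Hom (BettiUniverse.hodge hHD hY k) (((BettiUniverse.hodge hHD hZ l).tateTwist s).cast hs))) :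
    ∀ t ∈ (BettiUniverse.kunnethSummand hHD hY hZ (2 * c) ⟨(k, l), HasAntidiagonal.mem_antidiagonal.2 hkl⟩).hodgeClasses c,
      ofRatClass (ComplexPoints (Y ⊗ Z)) (2 * c) (BettiUniverse.crossMap Y Z hkl t) ∈ algebraicClasses (Y ⊗ Z) c := by
  intro t ht
  have hbot := (BettiUniverse.hodgeClasses_tensor_hodge_eq_bot_iff_subsingleton_hom_tateTwist hHD hY hZ k l hs).2 h
  rw [hcs] at hbot
  change t ∈ ((BettiUniverse.hodge hHD hY k).tensor (BettiUniverse.hodge hHD hZ l)).hodgeClasses c at ht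
  rw [hbot, Submodule.mem_bot] at ht
  rw [ht, map_zero, map_zero]
  exact Submodule.zero_mem _

/-- **The swapped form**: `Hom_HS(Hˡ(Z), Hᵏ(Y)(s')) = 0` with `s' = −s` also empties the piece `Hᵏ(Y) ⊗ Hˡ(Z)` (the two `Hom` spaces have the same dimension, the seat's g28-#1
`BettiUniverse.finrank_hom_hodge_tateTwist_swap`: transpose through polarizations). [cite: VoisinHodgeI2002, §11.3.3 Thm. 11.40, Lemma 11.41 and p. 286, §7.1.2] -/
theorem BettiUniverse.kunneth_piece_algebraic_of_subsingleton_hom_tateTwist_swap (hHD : exists_isReal_hodgeModel) (hY : IsSmoothProjective m Y) (hZ : IsSmoothProjective n Z) {k l c : ℕ}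
    (hkl : k + l = 2 * c) {s s' : ℤ} (hss' : -s = s') (hs : (l : ℤ) - 2 * s = k) (hs' : (k : ℤ) - 2 * s' = l) (hcs : (k : ℤ) + s = c)
    (h : Subsingleton (HodgeStructure.Hom (BettiUniverse.hodge hHD hZ l) (((BettiUniverse.hodge hHD hY k).tateTwist s').cast hs'))) :
    ∀ t ∈ (BettiUniverse.kunnethSummand hHD hY hZ (2 * c) ⟨(k, l), HasAntidiagonal.mem_antidiagonal.2 hkl⟩).hodgeClasses c,
      ofRatClass (ComplexPoints (Y ⊗ Z)) (2 * c) (BettiUniverse.crossMap Y Z hkl t) ∈ algebraicClasses (Y ⊗ Z) c := by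
  haveI := BettiUniverse.finite hY k
  haveI := BettiUniverse.finite hZ l
  intro t ht
  have hz : Module.finrank ℚ ↥(((BettiUniverse.hodge hHD hY k).tensor (BettiUniverse.hodge hHD hZ l)).hodgeClasses ((k : ℤ) + s)) = 0 := by
    rw [BettiUniverse.finrank_hodgeClasses_tensor_hodge_eq_finrank_hom_tateTwist hHD hY hZ k l hs, BettiUniverse.finrank_hom_hodge_tateTwist_swap hHD hY hZ k hss' hs hs']
    exact Module.finrank_zero_of_subsingleton
  have hbot := Submodule.finrank_eq_zero.1 hz
  rw [hcs] at hbot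
  change t ∈ ((BettiUniverse.hodge hHD hY k).tensor (BettiUniverse.hodge hHD hZ l)).hodgeClasses c at ht
  rw [hbot, Submodule.mem_bot] at ht
  rw [ht, map_zero, map_zero]
  exact Submodule.zero_mem _

/-- **The piece `H²(Y) ⊗ H²(Z)` of `H⁴(Y × Z)` is algebraic when `dim_ℚ Hom_HS(H²Y, H²Z) ≤ ρ(Y)ρ(Z)`**: the `ρ(Y)ρ(Z)` products of divisor classes are then ALL the Hodge classes of the piece (Lemma 11.41),
and products of divisor classes are algebraic (Lefschetz `(1,1)`, exterior products) — any smooth projective `Y`, `Z`. [cite: VoisinHodgeI2002, §11.3.3 Lemma 11.41, p. 287, §11.3.1 Thm. 11.30 and §6.2.3 Thm. 6.25]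
[cite: VoisinHodgeII2003, §9.2.4 Prop. 9.20] -/
theorem BettiUniverse.kunneth_two_two_algebraic_of_finrank_hom_le (hHD : exists_isReal_hodgeModel) (hY : IsSmoothProjective m Y) (hZ : IsSmoothProjective n Z)
    (h22 : Module.finrank ℚ (HodgeStructure.Hom (BettiUniverse.hodge hHD hY 2) (BettiUniverse.hodge hHD hZ 2)) ≤
      Module.finrank ℚ ↥((BettiUniverse.hodge hHD hY 2).hodgeClasses 1) * Module.finrank ℚ ↥((BettiUniverse.hodge hHD hZ 2).hodgeClasses 1)) :
    ∀ t ∈ (BettiUniverse.kunnethSummand hHD hY hZ (2 * 2) ⟨(2, 2), HasAntidiagonal.mem_antidiagonal.2 rfl⟩).hodgeClasses 2,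
      ofRatClass (ComplexPoints (Y ⊗ Z)) (2 * 2) (BettiUniverse.crossMap Y Z (show 2 + 2 = 2 * 2 by norm_num) t) ∈ algebraicClasses (Y ⊗ Z) 2 := by
  haveI := BettiUniverse.finite hY 2
  haveI := BettiUniverse.finite hZ 2
  intro t ht
  set P : Submodule ℚ (bettiCohomology Y 2 ⊗[ℚ] bettiCohomology Z 2) :=
    LinearMap.range (TensorProduct.mapIncl ((BettiUniverse.hodge hHD hY 2).hodgeClasses 1) ((BettiUniverse.hodge hHD hZ 2).hodgeClasses 1)) with hP
  have hPle : P ≤ ((BettiUniverse.hodge hHD hY 2).tensor (BettiUniverse.hodge hHD hZ 2)).hodgeClasses (1 + 1) := by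
    rw [hP, TensorProduct.range_mapIncl, Submodule.map₂_le]
    exact fun y hy z hz ↦ HodgeStructure.tmul_mem_hodgeClasses_tensor _ _ hy hz
  haveI : Module.Free ℚ ↥((BettiUniverse.hodge hHD hY 2).hodgeClasses 1) := Module.Free.of_divisionRing ℚ _
  haveI : Module.Free ℚ ↥((BettiUniverse.hodge hHD hZ 2).hodgeClasses 1) := Module.Free.of_divisionRing ℚ _
  have hPrank : Module.finrank ℚ ↥P = Module.finrank ℚ ↥((BettiUniverse.hodge hHD hY 2).hodgeClasses 1) * Module.finrank ℚ ↥((BettiUniverse.hodge hHD hZ 2).hodgeClasses 1) := by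
    rw [hP, LinearMap.finrank_range_of_inj (Module.Flat.tensorProduct_mapIncl_injective_of_right _ _), Module.finrank_tensorProduct]
  have hHrank : Module.finrank ℚ ↥(((BettiUniverse.hodge hHD hY 2).tensor (BettiUniverse.hodge hHD hZ 2)).hodgeClasses (1 + 1)) =
      Module.finrank ℚ (HodgeStructure.Hom (BettiUniverse.hodge hHD hY 2) (BettiUniverse.hodge hHD hZ 2)) := by
    rw [show (1 : ℤ) + 1 = ((2 : ℕ) : ℤ) by norm_num]
    exact BettiUniverse.finrank_hodgeClasses_tensor_hodge_eq_finrank_hom hHD hY hZ 2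
  have hPeq : P = ((BettiUniverse.hodge hHD hY 2).tensor (BettiUniverse.hodge hHD hZ 2)).hodgeClasses (1 + 1) :=
    Submodule.eq_of_le_of_finrank_le hPle (by rw [hHrank, hPrank]; exact h22)
  have ht' : t ∈ P := by
    rw [hPeq, show (1 : ℤ) + 1 = 2 by norm_num]
    exact ht
  rw [hP] at ht'
  obtain ⟨w, rfl⟩ := ht'
  clear ht
  induction w using TensorProduct.induction_on with
  | zero => rw [map_zero, map_zero, map_zero]; exact Submodule.zero_mem _
  | tmul p q =>
    rw [TensorProduct.mapIncl, TensorProduct.map_tmul, Submodule.subtype_apply, Submodule.subtype_apply]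
    have hpq := BettiUniverse.ofRatClass_crossMap_tmul_mem_algebraicClasses hY hZ ((BettiUniverse.mem_hodgeClasses_hodge_two_iff_ofRatClass_mem_algebraicClasses_one hHD hY _).1 p.2)
      ((BettiUniverse.mem_hodgeClasses_hodge_two_iff_ofRatClass_mem_algebraicClasses_one hHD hZ _).1 q.2)
    exact hpq
  | add x y hx hy => rw [map_add, map_add, map_add]; exact Submodule.add_mem _ hx hy

end Generic

/-! ### §2 Two threefolds: the pieces of `H⁶(T × T')` other than `H³(T) ⊗ H³(T')` -/

section Threefolds

variable [HodgeTensorFacts.{0, 0}] (μ : OrientationFamily)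

/-- **On `T × T'` (two smooth projective threefolds) the pieces of `H⁶` other than `H³(T) ⊗ H³(T')` carry only algebraic Hodge classes as soon as the piece `H²(T) ⊗ H²(T')` of `H⁴` does**:
`H⁰⊗H⁶`, `H⁶⊗H⁰` (`HC³` of a threefold: points), `H¹⊗H⁵`, `H⁵⊗H¹` (g29-#2 §5, all `Y`, `Z`), and `H²⊗H⁴`, `H⁴⊗H²` reduce by `id ⊗ L_η`, `L_η ⊗ id` to `H²⊗H²` (g29-#2 §3).
[cite: VoisinHodgeI2002, §6.2.3 Thm. 6.25, §11.3.1 Thm. 11.30, §11.3.3 Thm. 11.38–11.40 and p. 287] [cite: VoisinHodgeII2003, §9.2.4 Prop. 9.20] [cite: Voisin2013GHCBloch, Lemma 2.1] -/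
theorem BettiUniverse.kunneth_threefolds_ne_three_three_algebraic_of_two_two (hHD : exists_isReal_hodgeModel) (hT : IsSmoothProjective 3 T) (hT' : IsSmoothProjective 3 T')
    (h22 : ∀ t ∈ (BettiUniverse.kunnethSummand hHD hT hT' (2 * 2) ⟨(2, 2), HasAntidiagonal.mem_antidiagonal.2 rfl⟩).hodgeClasses 2,
      ofRatClass (ComplexPoints (T ⊗ T')) (2 * 2) (BettiUniverse.crossMap T T' (show 2 + 2 = 2 * 2 by norm_num) t) ∈ algebraicClasses (T ⊗ T') 2)
    (i' j' : ℕ) (hij' : i' + j' = 2 * 3) (hne : (i', j') ≠ (3, 3)) :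
    ∀ u ∈ (BettiUniverse.kunnethSummand hHD hT hT' (2 * 3) ⟨(i', j'), HasAntidiagonal.mem_antidiagonal.2 hij'⟩).hodgeClasses 3,
      ofRatClass (ComplexPoints (T ⊗ T')) (2 * 3) (BettiUniverse.crossMap T T' hij' u) ∈ algebraicClasses (T ⊗ T') 3 := by
  intro u hu
  have hTT' : IsSmoothProjective 6 (T ⊗ T') := hT.tensor_holds hT'
  have hHCT : HodgeConjectureFor 3 T := hodgeConjectureFor_of_dim_le_three_holds le_rfl hT
  have hHCT' : HodgeConjectureFor 3 T' := hodgeConjectureFor_of_dim_le_three_holds le_rfl hT'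
  have hi' : i' ≤ 6 := by omega
  interval_cases i'
  · obtain rfl : j' = 6 := by omega
    exact BettiUniverse.ofRatClass_crossMap_mem_algebraicClasses_of_fst_zero hHD hT hT' hij'
      (fun z hz ↦ hHCT'.2 3 _ (isRationalClass_ofRatClass _) ((BettiUniverse.mem_hodgeClasses_hodge_iff_isOfHodgeType hHD hT' 3 z).1 hz)) hu
  · obtain rfl : j' = 5 := by omega
    exact BettiUniverse.ofRatClass_crossMap_mem_algebraicClasses_one_tensor_top_sub_one hHD hT hT' hTT' (by norm_num) hij' hu
  · obtain rfl : j' = 4 := by omega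
    exact BettiUniverse.ofRatClass_crossMap_mem_algebraicClasses_of_hardLefschetz_right hHD hT hT' hTT' (j₀ := 2) (s := 1) (c₀ := 2) (by norm_num) (by norm_num) (by norm_num) hij' h22 hu
  · obtain rfl : j' = 3 := by omega
    exact absurd rfl hne
  · obtain rfl : j' = 2 := by omega
    exact BettiUniverse.ofRatClass_crossMap_mem_algebraicClasses_of_hardLefschetz_left hHD hT hT' hTT' (i₀ := 2) (s := 1) (c₀ := 2) (by norm_num) (by norm_num) (by norm_num) hij' h22 hu
  · obtain rfl : j' = 1 := by omega
    exact BettiUniverse.ofRatClass_crossMap_mem_algebraicClasses_top_sub_one_tensor_one hHD hT hT' hTT' (by norm_num) hij' hu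
  · obtain rfl : j' = 0 := by omega
    exact BettiUniverse.ofRatClass_crossMap_mem_algebraicClasses_of_snd_zero hHD hT hT' hij'
      (fun y hy ↦ hHCT.2 3 _ (isRationalClass_ofRatClass _) ((BettiUniverse.mem_hodgeClasses_hodge_iff_isOfHodgeType hHD hT 3 y).1 hy)) hu

/-- **The `(3,3)`-component of an algebraic class of `H⁶(T × T')` is algebraic and acts on `H³(T';ℂ) → H³(T;ℂ)` as the class** (once the `(2,2)`-piece of `H⁴` is algebraic).
[cite: VoisinHodgeI2002, §11.1.2 Prop. 11.20, §11.3.3 Thm. 11.38–11.40 and pp. 286–287] [cite: Voisin2025, §3.2.1 (12)–(14), Prop. 3.8 and Cor. 3.9] -/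
theorem BettiUniverse.exists_kunneth_three_three_algebraic_corrAction_eq_of_two_two (hHD : exists_isReal_hodgeModel) (hT : IsSmoothProjective 3 T) (hT' : IsSmoothProjective 3 T')
    (h22 : ∀ t ∈ (BettiUniverse.kunnethSummand hHD hT hT' (2 * 2) ⟨(2, 2), HasAntidiagonal.mem_antidiagonal.2 rfl⟩).hodgeClasses 2,
      ofRatClass (ComplexPoints (T ⊗ T')) (2 * 2) (BettiUniverse.crossMap T T' (show 2 + 2 = 2 * 2 by norm_num) t) ∈ algebraicClasses (T ⊗ T') 2)
    {γ : bettiCohomology (T ⊗ T') (2 * 3)} (hγ : ofRatClass (ComplexPoints (T ⊗ T')) (2 * 3) γ ∈ algebraicClasses (T ⊗ T') 3) :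
    ∃ t ∈ (BettiUniverse.kunnethSummand hHD hT hT' (2 * 3) ⟨(3, 3), HasAntidiagonal.mem_antidiagonal.2 rfl⟩).hodgeClasses 3,
      ofRatClass (ComplexPoints (T ⊗ T')) (2 * 3) (BettiUniverse.crossMap T T' (show 3 + 3 = 2 * 3 by norm_num) t) ∈ algebraicClasses (T ⊗ T') 3 ∧
      corrAction μ hT hT' (rfl : 3 + 2 * 3 = 3 + 2 * 3) (ofRatClass (ComplexPoints (T ⊗ T')) (2 * 3) (BettiUniverse.crossMap T T' (show 3 + 3 = 2 * 3 by norm_num) t)) =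
        corrAction μ hT hT' (rfl : 3 + 2 * 3 = 3 + 2 * 3) (ofRatClass (ComplexPoints (T ⊗ T')) (2 * 3) γ) :=
  BettiUniverse.exists_kunneth_algebraic_corrAction_eq_of_forall_ne μ hHD hT hT' (show 3 + 3 = 2 * 3 by norm_num) rfl (BettiUniverse.kunneth_threefolds_ne_three_three_algebraic_of_two_two hHD hT hT' h22) hγ

/-! ### §3 `HC(T × T')` with the middle piece by correspondences -/

/-- **`HC(T × T') ⟺ dim_ℚ Hom_HS(H³T, H³T') ≤ dim_ℂ ⟨actions H³(T';ℂ) → H³(T;ℂ) of the rational algebraic classes of H⁶(T × T')⟩`, given the `H⁴`-pieces `H¹T ⊗ H³T'`, `H²T ⊗ H²T'`, `H³T ⊗ H¹T'`**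
(two smooth projective threefolds; g29-#3 `…_of_kunneth_pieces` for `⟸`, the numeric criterion of g30-#5 §1 on the middle piece). [cite: VoisinHodgeI2002, §11.3.3 Thm. 11.38–11.40, Lemma 11.41 and pp. 286–287]
[cite: Voisin2025, §3.2.1 (12)–(14), Prop. 3.8 and Cor. 3.9] [cite: Deligne2000, §1] -/
theorem BettiUniverse.hodgeConjectureFor_tensor_threefolds_iff_finrank_hom_le_finrank_span_of_kunneth_pieces (hHD : exists_isReal_hodgeModel) (hT : IsSmoothProjective 3 T)
    (hT' : IsSmoothProjective 3 T') (hTT' : IsSmoothProjective 6 (T ⊗ T'))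
    (h13 : ∀ t ∈ (BettiUniverse.kunnethSummand hHD hT hT' (2 * 2) ⟨(1, 3), HasAntidiagonal.mem_antidiagonal.2 rfl⟩).hodgeClasses 2,
      ofRatClass (ComplexPoints (T ⊗ T')) (2 * 2) (BettiUniverse.crossMap T T' (show 1 + 3 = 2 * 2 by norm_num) t) ∈ algebraicClasses (T ⊗ T') 2)
    (h22 : ∀ t ∈ (BettiUniverse.kunnethSummand hHD hT hT' (2 * 2) ⟨(2, 2), HasAntidiagonal.mem_antidiagonal.2 rfl⟩).hodgeClasses 2,
      ofRatClass (ComplexPoints (T ⊗ T')) (2 * 2) (BettiUniverse.crossMap T T' (show 2 + 2 = 2 * 2 by norm_num) t) ∈ algebraicClasses (T ⊗ T') 2)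
    (h31 : ∀ t ∈ (BettiUniverse.kunnethSummand hHD hT hT' (2 * 2) ⟨(3, 1), HasAntidiagonal.mem_antidiagonal.2 rfl⟩).hodgeClasses 2,
      ofRatClass (ComplexPoints (T ⊗ T')) (2 * 2) (BettiUniverse.crossMap T T' (show 3 + 1 = 2 * 2 by norm_num) t) ∈ algebraicClasses (T ⊗ T') 2) :
    HodgeConjectureFor 6 (T ⊗ T') ↔
      Module.finrank ℚ (HodgeStructure.Hom (BettiUniverse.hodge hHD hT 3) (BettiUniverse.hodge hHD hT' 3)) ≤
        Module.finrank ℂ ↥(Submodule.span ℂ ((fun γ ↦ corrAction μ hT hT' (rfl : 3 + 2 * 3 = 3 + 2 * 3) (ofRatClass (ComplexPoints (T ⊗ T')) (2 * 3) γ)) ''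
          {γ : bettiCohomology (T ⊗ T') (2 * 3) | ofRatClass (ComplexPoints (T ⊗ T')) (2 * 3) γ ∈ algebraicClasses (T ⊗ T') 3})) := by
  have hother := BettiUniverse.kunneth_threefolds_ne_three_three_algebraic_of_two_two hHD hT hT' h22
  rw [← BettiUniverse.finrank_hodgeClasses_tensor_hodge_eq_finrank_hom hHD hT hT' 3,
    ← BettiUniverse.kunneth_piece_algebraic_iff_finrank_le_of_forall_ne μ hHD hT hT' (show 3 + 3 = 2 * 3 by norm_num) (show 3 + 3 = 2 * 3 by norm_num) rfl hother]
  constructor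
  · intro hHC t ht
    obtain ⟨γ, hγ, hact⟩ := BettiUniverse.forall_exists_corrAction_eq_of_hodgeConjectureFor_tensor μ hHD hT hT' hTT' hHC (show 3 + 3 = 2 * 3 by norm_num) (rfl : 3 + 2 * 3 = 3 + 2 * 3) ht
    exact BettiUniverse.ofRatClass_crossMap_mem_algebraicClasses_of_corrAction_eq_of_forall_ne μ hHD hT hT' (show 3 + 3 = 2 * 3 by norm_num) (show 3 + 3 = 2 * 3 by norm_num) rfl hother hγ hact
  · intro h33
    exact BettiUniverse.hodgeConjectureFor_tensor_threefolds_of_kunneth_pieces hHD hT hT' hTT' h13 h22 h31 h33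

/-- **Family form**: the `H⁴`-pieces `(1,3)`, `(2,2)`, `(3,1)` algebraic, `|ι|` rational algebraic classes of `H⁶(T × T')` with ℂ-linearly independent actions `H³(T';ℂ) → H³(T;ℂ)`, and
`dim_ℚ Hom_HS(H³T, H³T') ≤ |ι|` ⇒ `HC(T × T')`. [cite: VoisinHodgeI2002, §11.3.3 Thm. 11.38–11.40, Lemma 11.41 and pp. 286–287] [cite: Voisin2025, §3.2.1 (12)–(14), Prop. 3.8 and Cor. 3.9] [cite: Deligne2000, §1] -/
theorem BettiUniverse.hodgeConjectureFor_tensor_threefolds_of_kunneth_pieces_of_linearIndependent_corrAction {ι : Type} [Fintype ι] (hHD : exists_isReal_hodgeModel) (hT : IsSmoothProjective 3 T)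
    (hT' : IsSmoothProjective 3 T') (hTT' : IsSmoothProjective 6 (T ⊗ T'))
    (h13 : ∀ t ∈ (BettiUniverse.kunnethSummand hHD hT hT' (2 * 2) ⟨(1, 3), HasAntidiagonal.mem_antidiagonal.2 rfl⟩).hodgeClasses 2,
      ofRatClass (ComplexPoints (T ⊗ T')) (2 * 2) (BettiUniverse.crossMap T T' (show 1 + 3 = 2 * 2 by norm_num) t) ∈ algebraicClasses (T ⊗ T') 2)
    (h22 : ∀ t ∈ (BettiUniverse.kunnethSummand hHD hT hT' (2 * 2) ⟨(2, 2), HasAntidiagonal.mem_antidiagonal.2 rfl⟩).hodgeClasses 2,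
      ofRatClass (ComplexPoints (T ⊗ T')) (2 * 2) (BettiUniverse.crossMap T T' (show 2 + 2 = 2 * 2 by norm_num) t) ∈ algebraicClasses (T ⊗ T') 2)
    (h31 : ∀ t ∈ (BettiUniverse.kunnethSummand hHD hT hT' (2 * 2) ⟨(3, 1), HasAntidiagonal.mem_antidiagonal.2 rfl⟩).hodgeClasses 2,
      ofRatClass (ComplexPoints (T ⊗ T')) (2 * 2) (BettiUniverse.crossMap T T' (show 3 + 1 = 2 * 2 by norm_num) t) ∈ algebraicClasses (T ⊗ T') 2)
    (γ : ι → bettiCohomology (T ⊗ T') (2 * 3)) (hγ : ∀ k, ofRatClass (ComplexPoints (T ⊗ T')) (2 * 3) (γ k) ∈ algebraicClasses (T ⊗ T') 3)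
    (hind : LinearIndependent ℂ fun k ↦ corrAction μ hT hT' (rfl : 3 + 2 * 3 = 3 + 2 * 3) (ofRatClass (ComplexPoints (T ⊗ T')) (2 * 3) (γ k)))
    (hHom : Module.finrank ℚ (HodgeStructure.Hom (BettiUniverse.hodge hHD hT 3) (BettiUniverse.hodge hHD hT' 3)) ≤ Fintype.card ι) : HodgeConjectureFor 6 (T ⊗ T') := by
  refine BettiUniverse.hodgeConjectureFor_tensor_threefolds_of_kunneth_pieces hHD hT hT' hTT' h13 h22 h31 ?_
  refine BettiUniverse.kunneth_piece_algebraic_of_linearIndependent_corrAction_of_forall_ne μ hHD hT hT' (show 3 + 3 = 2 * 3 by norm_num) (show 3 + 3 = 2 * 3 by norm_num) rfl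
    (BettiUniverse.kunneth_threefolds_ne_three_three_algebraic_of_two_two hHD hT hT' h22) γ hγ hind ?_
  rwa [BettiUniverse.finrank_hodgeClasses_tensor_hodge_eq_finrank_hom hHD hT hT' 3]

/-! ### §4 Hom forms -/

/-- **`HC(T × T')` from `Hom_HS(H¹T, H³T'(1)) = 0`, `Hom_HS(H¹T', H³T(1)) = 0`, `dim_ℚ Hom_HS(H²T, H²T') ≤ ρ(T)ρ(T')` and the numeric criterion on the middle piece** (g29-#3 had `Hom_HS(H³T, H³T') = 0`
instead of the last). [cite: VoisinHodgeI2002, §11.3.3 Thm. 11.38–11.40, Lemma 11.41 and pp. 286–287, §11.3.1 Thm. 11.30, §6.2.3 Thm. 6.25] [cite: Voisin2025, §3.2.1 (12)–(14), Prop. 3.8 and Cor. 3.9] [cite: Deligne2000, §1] -/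
theorem BettiUniverse.hodgeConjectureFor_tensor_threefolds_of_hom_odd_of_finrank_hom_le_of_finrank_hom_three_le_finrank_span (hHD : exists_isReal_hodgeModel) (hT : IsSmoothProjective 3 T)
    (hT' : IsSmoothProjective 3 T') (hTT' : IsSmoothProjective 6 (T ⊗ T'))
    (h13 : Subsingleton (HodgeStructure.Hom (BettiUniverse.hodge hHD hT 1) (((BettiUniverse.hodge hHD hT' 3).tateTwist 1).cast (by norm_num))))
    (h13' : Subsingleton (HodgeStructure.Hom (BettiUniverse.hodge hHD hT' 1) (((BettiUniverse.hodge hHD hT 3).tateTwist 1).cast (by norm_num))))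
    (h22 : Module.finrank ℚ (HodgeStructure.Hom (BettiUniverse.hodge hHD hT 2) (BettiUniverse.hodge hHD hT' 2)) ≤
      Module.finrank ℚ ↥((BettiUniverse.hodge hHD hT 2).hodgeClasses 1) * Module.finrank ℚ ↥((BettiUniverse.hodge hHD hT' 2).hodgeClasses 1))
    (h33 : Module.finrank ℚ (HodgeStructure.Hom (BettiUniverse.hodge hHD hT 3) (BettiUniverse.hodge hHD hT' 3)) ≤
      Module.finrank ℂ ↥(Submodule.span ℂ ((fun γ ↦ corrAction μ hT hT' (rfl : 3 + 2 * 3 = 3 + 2 * 3) (ofRatClass (ComplexPoints (T ⊗ T')) (2 * 3) γ)) ''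
        {γ : bettiCohomology (T ⊗ T') (2 * 3) | ofRatClass (ComplexPoints (T ⊗ T')) (2 * 3) γ ∈ algebraicClasses (T ⊗ T') 3}))) :
    HodgeConjectureFor 6 (T ⊗ T') :=
  (BettiUniverse.hodgeConjectureFor_tensor_threefolds_iff_finrank_hom_le_finrank_span_of_kunneth_pieces μ hHD hT hT' hTT'
    (BettiUniverse.kunneth_piece_algebraic_of_subsingleton_hom_tateTwist hHD hT hT' (show 1 + 3 = 2 * 2 by norm_num) (s := 1) (by norm_num) (by norm_num) h13)
    (BettiUniverse.kunneth_two_two_algebraic_of_finrank_hom_le hHD hT hT' h22)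
    (BettiUniverse.kunneth_piece_algebraic_of_subsingleton_hom_tateTwist_swap hHD hT hT' (show 3 + 1 = 2 * 2 by norm_num) (s := -1) (s' := 1) (by norm_num) (by norm_num) (by norm_num) (by norm_num)
      h13')).2 h33

/-- **`HC(T × T')` for `q(T) = q(T') = 0` and `h^{2,0}(T) = 0` from the numeric criterion on the middle piece alone**: `H¹ = 0` kills the pieces `(1,3)`, `(3,1)`, and `H²(T)` of pure type `(1,1)` forces
`dim Hom_HS(H²T, H²T') = ρ(T)ρ(T')` (Deligne 2.1.13) — e.g. quintic or Calabi–Yau threefolds `T` against any regular `T'`. [cite: VoisinHodgeI2002, §11.3.3 Thm. 11.38–11.40, Lemma 11.41 and pp. 286–287, §6.1.3 Cor. 6.13]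
[cite: DeligneHodgeII1971, 2.1.13] [cite: Voisin2025, §3.2.1 (12)–(14), Prop. 3.8 and Cor. 3.9] [cite: Deligne2000, §1] -/
theorem BettiUniverse.hodgeConjectureFor_tensor_threefolds_of_q_zero_of_h20_zero_of_finrank_hom_three_le_finrank_span (hHD : exists_isReal_hodgeModel) (hT : IsSmoothProjective 3 T)
    (hT' : IsSmoothProjective 3 T') (hTT' : IsSmoothProjective 6 (T ⊗ T')) (hq : (BettiUniverse.hodge hHD hT 1).hodgeNumber 1 0 = 0) (hq' : (BettiUniverse.hodge hHD hT' 1).hodgeNumber 1 0 = 0)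
    (h20 : (BettiUniverse.hodge hHD hT 2).hodgeNumber 2 0 = 0)
    (h33 : Module.finrank ℚ (HodgeStructure.Hom (BettiUniverse.hodge hHD hT 3) (BettiUniverse.hodge hHD hT' 3)) ≤
      Module.finrank ℂ ↥(Submodule.span ℂ ((fun γ ↦ corrAction μ hT hT' (rfl : 3 + 2 * 3 = 3 + 2 * 3) (ofRatClass (ComplexPoints (T ⊗ T')) (2 * 3) γ)) ''
        {γ : bettiCohomology (T ⊗ T') (2 * 3) | ofRatClass (ComplexPoints (T ⊗ T')) (2 * 3) γ ∈ algebraicClasses (T ⊗ T') 3}))) :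
    HodgeConjectureFor 6 (T ⊗ T') := by
  haveI := BettiUniverse.finite hT 1
  haveI := BettiUniverse.finite hT' 1
  haveI := BettiUniverse.finite hT 2
  haveI := BettiUniverse.finite hT' 2
  haveI : Subsingleton (bettiCohomology T 1) := Module.finrank_zero_iff.1 ((BettiUniverse.finrank_bettiCohomology_one_eq_zero_iff hHD hT).2 hq)
  haveI : Subsingleton (bettiCohomology T' 1) := Module.finrank_zero_iff.1 ((BettiUniverse.finrank_bettiCohomology_one_eq_zero_iff hHD hT').2 hq')
  refine BettiUniverse.hodgeConjectureFor_tensor_threefolds_of_hom_odd_of_finrank_hom_le_of_finrank_hom_three_le_finrank_span μ hHD hT hT' hTT'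
    HodgeStructure.Hom.toLinearMap_injective.subsingleton HodgeStructure.Hom.toLinearMap_injective.subsingleton (le_of_eq ?_) h33
  have htop : (BettiUniverse.hodge hHD hT 2).hodgeClasses 1 = ⊤ := (BettiUniverse.hodgeClasses_hodge_two_eq_top_iff hHD hT).2 h20
  have e := BettiUniverse.finrank_hodgeClasses_tensor_hodge_of_hodgeClasses_eq_top_left hHD hT hT' (i := 2) (a := 1) (by norm_num) htop 2 1
  rw [show (1 : ℤ) + 1 = ((2 : ℕ) : ℤ) by norm_num] at e
  rw [← BettiUniverse.finrank_hodgeClasses_tensor_hodge_eq_finrank_hom hHD hT hT' 2, e, htop, finrank_top]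

/-- **The square of a regular threefold with `h^{2,0} = 0`: `HC(T × T) ⟺ dim_ℚ End_HS(H³T) ≤ dim_ℂ ⟨actions on H³(T;ℂ) of the rational algebraic classes of H⁶(T × T)⟩`** (quintic threefolds, Calabi–Yau
threefolds: «`End_HS(H³T)` is generated by algebraic self-correspondences»; g29-#5 was the case `dim End_HS(H³T) ≤ 1`, realised by the diagonal). [cite: VoisinHodgeI2002, §11.3.3 Thm. 11.38–11.40, Lemma 11.41 and pp. 286–287]
[cite: Voisin2025, §3.2.1 (12)–(14), Prop. 3.8 and Cor. 3.9] [cite: Deligne2000, §1] -/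
theorem BettiUniverse.hodgeConjectureFor_tensor_self_threefold_iff_finrank_end_le_finrank_span_of_q_zero_of_h20_zero (hHD : exists_isReal_hodgeModel) (hT : IsSmoothProjective 3 T)
    (hTT : IsSmoothProjective 6 (T ⊗ T)) (hq : (BettiUniverse.hodge hHD hT 1).hodgeNumber 1 0 = 0) (h20 : (BettiUniverse.hodge hHD hT 2).hodgeNumber 2 0 = 0) :
    HodgeConjectureFor 6 (T ⊗ T) ↔
      Module.finrank ℚ (HodgeStructure.Hom (BettiUniverse.hodge hHD hT 3) (BettiUniverse.hodge hHD hT 3)) ≤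
        Module.finrank ℂ ↥(Submodule.span ℂ ((fun γ ↦ corrAction μ hT hT (rfl : 3 + 2 * 3 = 3 + 2 * 3) (ofRatClass (ComplexPoints (T ⊗ T)) (2 * 3) γ)) ''
          {γ : bettiCohomology (T ⊗ T) (2 * 3) | ofRatClass (ComplexPoints (T ⊗ T)) (2 * 3) γ ∈ algebraicClasses (T ⊗ T) 3})) := by
  haveI := BettiUniverse.finite hT 1
  haveI := BettiUniverse.finite hT 2
  haveI : Subsingleton (bettiCohomology T 1) := Module.finrank_zero_iff.1 ((BettiUniverse.finrank_bettiCohomology_one_eq_zero_iff hHD hT).2 hq)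
  have h13 : Subsingleton (HodgeStructure.Hom (BettiUniverse.hodge hHD hT 1) (((BettiUniverse.hodge hHD hT 3).tateTwist 1).cast (by norm_num))) :=
    HodgeStructure.Hom.toLinearMap_injective.subsingleton
  have htop : (BettiUniverse.hodge hHD hT 2).hodgeClasses 1 = ⊤ := (BettiUniverse.hodgeClasses_hodge_two_eq_top_iff hHD hT).2 h20
  have h22 : Module.finrank ℚ (HodgeStructure.Hom (BettiUniverse.hodge hHD hT 2) (BettiUniverse.hodge hHD hT 2)) ≤
      Module.finrank ℚ ↥((BettiUniverse.hodge hHD hT 2).hodgeClasses 1) * Module.finrank ℚ ↥((BettiUniverse.hodge hHD hT 2).hodgeClasses 1) := by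
    refine le_of_eq ?_
    have e := BettiUniverse.finrank_hodgeClasses_tensor_hodge_of_hodgeClasses_eq_top_left hHD hT hT (i := 2) (a := 1) (by norm_num) htop 2 1
    rw [show (1 : ℤ) + 1 = ((2 : ℕ) : ℤ) by norm_num] at e
    rw [← BettiUniverse.finrank_hodgeClasses_tensor_hodge_eq_finrank_hom hHD hT hT 2, e, htop, finrank_top]
  exact BettiUniverse.hodgeConjectureFor_tensor_threefolds_iff_finrank_hom_le_finrank_span_of_kunneth_pieces μ hHD hT hT hTT
    (BettiUniverse.kunneth_piece_algebraic_of_subsingleton_hom_tateTwist hHD hT hT (show 1 + 3 = 2 * 2 by norm_num) (s := 1) (by norm_num) (by norm_num) h13)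
    (BettiUniverse.kunneth_two_two_algebraic_of_finrank_hom_le hHD hT hT h22)
    (BettiUniverse.kunneth_piece_algebraic_of_subsingleton_hom_tateTwist_swap hHD hT hT (show 3 + 1 = 2 * 2 by norm_num) (s := -1) (s' := 1) (by norm_num) (by norm_num) (by norm_num) (by norm_num) h13)

end Threefolds

end Literature.AlgebraicGeometry.HodgeTheory

end
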